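import Summits.KontsevichZagierPeriods.KontsevichZagierPeriods.Theorems.HurwitzMicroSectorsNormalFormPrincipleLevelOneTowerReduction
import Summits.KontsevichZagierPeriods.KontsevichZagierPeriods.Theorems.HurwitzMicroSectorsNormalFormPrincipleLevelOneIndepZetaOfPiOddZeta

/-!
# `NormalFormPrinciple` (stmt-KontsevichZagierPeriods-3869), line `SketchIdeator1` — the level-one box
# tower, III: CONJECTURE 1 ON THE TOWER ⟸ `Indep_ℚ(1, ζ(2), …, ζ(D))`

Pure proof file (`--supports` the crux; registered sub-goals `boxRigidity_levelOne_tower`,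
`tower_mem_relations_of_eval_eq_zero`, `boxRigidity_levelOne_le_three`).
The LEVEL-ONE BOX TOWER of the leaf `stub_boxRigidity` (lead seat c7, cycle 9 of crux
stmt-KontsevichZagierPeriods-3869, line `SketchIdeator1`): all representations
`[(0,1)ʷ, P(x)/(1 − x₀⋯x_{w−1})]`, `P ∈ ℚ[x₀,…,x_{w−1}]`, `w ≥ 2` — the natural completion of the route's
diagonal Hurwitz rungs and of Beukers' integrals `∫_{(0,1)ʷ} dx/(1 − ∏xᵢ) = ζ(w)`; values
`Σ_{j=2}^{w} c_j ζ(j) + c₀`. Engine: the merge gadget with spectators (rules 2, 3; see part II), coordinate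
permutations, the diagonal identity (rule 1b) and the collapse of polynomial boxes to rational points;
normal form `Σ_{j=2}^{w} [(0,1)ʲ, β_j/(1 − ∏x)] + [pt, q]`.
Sources: M. Kontsevich, D. Zagier, *Periods* (2001), §1.1–1.2; F. Beukers, Bull. LMS 11 (1979).
No definitions are introduced.

This file: tower normal forms on the subgroup generated by the tower of heights `≤ D` and all
polynomial boxes; the KERNEL THEOREM `tower_mem_relations_of_eval_eq_zero` — a `ℤ`-combination with
value `0` is a KZ relation — conditionally on the vanishing of every rational relation
`Σ_{2≤j≤D} n_j ζ(j) + r = 0` (`Indep_ℚ(1, ζ(2), …, ζ(D))`, a folklore open conjecture implied by the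
algebraic independence of `π, ζ(3), ζ(5), …`); hence **Conjecture 1 of Kontsevich–Zagier on the whole
level-one box tower of height `≤ D`** (`boxRigidity_levelOne_tower`, across dimensions, plus the mixed
pairs with polynomial boxes). The hypothesis is DISCHARGED at height `2` (`π² ∉ ℚ`, Lindemann:
`boxRigidity_levelOne_tower_two`, unconditional) and reduced at height `3` to the single typed leaf of
the first join rung, the `ℚ`-linear independence of `1, π², ζ(3)` (`boxRigidity_levelOne_le_three`); for ALL heights at once
it follows from the tree's standing conjecture `PiOddZetaAlgebraicIndependent`
(`tower_mem_relations_of_eval_eq_zero_of_piOddZeta`, `boxRigidity_levelOne_tower_of_piOddZeta`).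
-/

noncomputable section

open MeasureTheory Set
open scoped Polynomial
open Literature.NumberTheory.Transcendental Literature.NumberTheory.Transcendental.KZ
open Literature.ModelTheory.ExponentialFields (IsSemialgebraic)

namespace Summit.KontsevichZagierPeriods.HurwitzMicroSectors.NormalFormPrinciple.PiBox.LevelOne

open Summit.KontsevichZagierPeriods.HurwitzMicroSectors.NormalFormPrinciple.PiBox.Dlog
  (exists_ptCarrier value_pt pt_add_mem_relations pt_zero_mem_relations pt_congr_mem_relations)

/-! ## Composition (lead), part IV: Conjecture 1 on the tower -/

/-! ### Normal forms on the subgroup generated by the tower (heights `≤ D`) and the polynomial boxes -/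

/-- **Additivity of tower normal forms.** [cite: KontsevichZagier2001, §1.2 rule (1)] -/
theorem towerNF_add {D : ℕ} {c₁ c₂ : FormalRep} {β₁ β₂ : ℕ → ℚ} {q₁ q₂ : ℚ}
    (h₁ : ∀ (B : (j : ℕ) → IntegralRep j) (Z : IntegralRep 0),
        (∀ j ∈ Finset.Icc 2 D, (B j).domain = {x | ∀ i, x i ∈ Set.Ioo (0:ℝ) 1} ∧
          EqOn (B j).integrand (fun x => (β₁ j : ℝ) / (1 - ∏ i, x i)) (B j).domain) →
        Z.domain = Set.univ → (Z.integrand = fun _ => (q₁ : ℝ)) →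
        c₁ - (∑ j ∈ Finset.Icc 2 D, of (B j)) - of Z ∈ relations)
    (h₂ : ∀ (B : (j : ℕ) → IntegralRep j) (Z : IntegralRep 0),
        (∀ j ∈ Finset.Icc 2 D, (B j).domain = {x | ∀ i, x i ∈ Set.Ioo (0:ℝ) 1} ∧
          EqOn (B j).integrand (fun x => (β₂ j : ℝ) / (1 - ∏ i, x i)) (B j).domain) →
        Z.domain = Set.univ → (Z.integrand = fun _ => (q₂ : ℝ)) →
        c₂ - (∑ j ∈ Finset.Icc 2 D, of (B j)) - of Z ∈ relations) :
    ∀ (B : (j : ℕ) → IntegralRep j) (Z : IntegralRep 0),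
        (∀ j ∈ Finset.Icc 2 D, (B j).domain = {x | ∀ i, x i ∈ Set.Ioo (0:ℝ) 1} ∧
          EqOn (B j).integrand (fun x => ((β₁ + β₂) j : ℝ) / (1 - ∏ i, x i)) (B j).domain) →
        Z.domain = Set.univ → (Z.integrand = fun _ => ((q₁ + q₂ : ℚ) : ℝ)) →
        (c₁ + c₂) - (∑ j ∈ Finset.Icc 2 D, of (B j)) - of Z ∈ relations := by
  intro B Z hB hZd hZi
  obtain ⟨B₁, hB₁⟩ := exists_zetaCarriers β₁
  obtain ⟨B₂, hB₂⟩ := exists_zetaCarriers β₂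
  obtain ⟨Zf, hZf⟩ := exists_ptCarrier
  have e₁ := h₁ B₁ (Zf q₁) (fun j hj => hB₁ j (Finset.mem_Icc.1 hj).1) (hZf q₁).1 (hZf q₁).2
  have e₂ := h₂ B₂ (Zf q₂) (fun j hj => hB₂ j (Finset.mem_Icc.1 hj).1) (hZf q₂).1 (hZf q₂).2
  have eB := sum_carriers_add (d := D) B B₁ B₂
    (fun j hj => ⟨(hB j hj).1, by simpa only [Pi.add_apply] using (hB j hj).2⟩)
    (fun j hj => hB₁ j (Finset.mem_Icc.1 hj).1) (fun j hj => hB₂ j (Finset.mem_Icc.1 hj).1)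
  have eZ := pt_add_mem_relations Z (Zf q₁) (Zf q₂) hZd (hZf q₁).1 (hZf q₂).1
    (by rw [hZi]; push_cast; rfl) (hZf q₁).2 (hZf q₂).2
  have e : (c₁ + c₂) - (∑ j ∈ Finset.Icc 2 D, of (B j)) - of Z =
      (c₁ - (∑ j ∈ Finset.Icc 2 D, of (B₁ j)) - of (Zf q₁)) +
      (c₂ - (∑ j ∈ Finset.Icc 2 D, of (B₂ j)) - of (Zf q₂)) -
      ((∑ j ∈ Finset.Icc 2 D, of (B j)) - (∑ j ∈ Finset.Icc 2 D, of (B₁ j)) -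
        ∑ j ∈ Finset.Icc 2 D, of (B₂ j)) -
      (of Z - of (Zf q₁) - of (Zf q₂)) := by abel
  rw [e]
  exact relations.sub_mem (relations.sub_mem (relations.add_mem e₁ e₂) eB) eZ

/-- **Negation of tower normal forms.** [cite: KontsevichZagier2001, §1.2 rule (1)] -/
theorem towerNF_neg {D : ℕ} {c : FormalRep} {β : ℕ → ℚ} {q : ℚ}
    (h : ∀ (B : (j : ℕ) → IntegralRep j) (Z : IntegralRep 0),
        (∀ j ∈ Finset.Icc 2 D, (B j).domain = {x | ∀ i, x i ∈ Set.Ioo (0:ℝ) 1} ∧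
          EqOn (B j).integrand (fun x => (β j : ℝ) / (1 - ∏ i, x i)) (B j).domain) →
        Z.domain = Set.univ → (Z.integrand = fun _ => (q : ℝ)) →
        c - (∑ j ∈ Finset.Icc 2 D, of (B j)) - of Z ∈ relations) :
    ∀ (B : (j : ℕ) → IntegralRep j) (Z : IntegralRep 0),
        (∀ j ∈ Finset.Icc 2 D, (B j).domain = {x | ∀ i, x i ∈ Set.Ioo (0:ℝ) 1} ∧
          EqOn (B j).integrand (fun x => ((-β) j : ℝ) / (1 - ∏ i, x i)) (B j).domain) →
        Z.domain = Set.univ → (Z.integrand = fun _ => ((-q : ℚ) : ℝ)) →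
        (-c) - (∑ j ∈ Finset.Icc 2 D, of (B j)) - of Z ∈ relations := by
  intro B Z hB hZd hZi
  obtain ⟨B₁, hB₁⟩ := exists_zetaCarriers β
  obtain ⟨Zf, hZf⟩ := exists_ptCarrier
  have e₁ := h B₁ (Zf q) (fun j hj => hB₁ j (Finset.mem_Icc.1 hj).1) (hZf q).1 (hZf q).2
  have eB := sum_carriers_add_neg (d := D) B₁ B (fun j hj => hB₁ j (Finset.mem_Icc.1 hj).1)
    (fun j hj => ⟨(hB j hj).1, by simpa only [Pi.neg_apply] using (hB j hj).2⟩)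
  have eZ : of (Zf q) + of Z ∈ relations :=
    of_add_of_mem_relations_of_eqOn_neg (hZd.trans (hZf q).1.symm) fun x _ => by
      rw [Pi.neg_apply, (hZf q).2, hZi]
      push_cast
      ring
  have e : (-c) - (∑ j ∈ Finset.Icc 2 D, of (B j)) - of Z =
      -(c - (∑ j ∈ Finset.Icc 2 D, of (B₁ j)) - of (Zf q)) -
        ((∑ j ∈ Finset.Icc 2 D, of (B₁ j)) + ∑ j ∈ Finset.Icc 2 D, of (B j)) - (of (Zf q) + of Z) := by
    abel
  rw [e]
  exact relations.sub_mem (relations.sub_mem (relations.neg_mem e₁) eB) eZ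

/-- **Tower normal forms on the subgroup.** Every element of the subgroup of `FormalRep` generated by the
level-one box tower of heights `2 ≤ w ≤ D` and by all polynomial boxes `[(0,1)ᵐ, p]` has a tower
normal form of height `D`. [cite: KontsevichZagier2001, §1.2] -/
theorem exists_towerNF_of_mem_closure {D : ℕ} {c : FormalRep}
    (hc : c ∈ AddSubgroup.closure
      ({y : FormalRep | ∃ (k : ℕ) (_ : k + 2 ≤ D) (P : MvPolynomial (Fin (k + 2)) ℚ)
          (N : IntegralRep (k + 2)), N.domain = {x | ∀ i, x i ∈ Set.Ioo (0:ℝ) 1} ∧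
          EqOn N.integrand (fun x => (MvPolynomial.aeval x P : ℝ) / (1 - ∏ i, x i)) N.domain ∧
          y = of N} ∪
       {y : FormalRep | ∃ (m : ℕ) (p : MvPolynomial (Fin m) ℚ) (N : IntegralRep m),
          N.domain = {x | ∀ i, x i ∈ Set.Ioo (0:ℝ) 1} ∧
          EqOn N.integrand (fun x => (MvPolynomial.aeval x p : ℝ)) N.domain ∧ y = of N})) :
    ∃ (β : ℕ → ℚ) (q : ℚ), (∀ j, D < j → β j = 0) ∧
      ∀ (B : (j : ℕ) → IntegralRep j) (Z : IntegralRep 0),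
        (∀ j ∈ Finset.Icc 2 D, (B j).domain = {x | ∀ i, x i ∈ Set.Ioo (0:ℝ) 1} ∧
          EqOn (B j).integrand (fun x => (β j : ℝ) / (1 - ∏ i, x i)) (B j).domain) →
        Z.domain = Set.univ → (Z.integrand = fun _ => (q : ℝ)) →
        c - (∑ j ∈ Finset.Icc 2 D, of (B j)) - of Z ∈ relations := by
  induction hc using AddSubgroup.closure_induction with
  | mem y hy =>
    rcases hy with ⟨k, hk, P, N, hNd, hNi, rfl⟩ | ⟨m, p, N, hNd, hNi, rfl⟩
    · obtain ⟨β, q, hβ, h⟩ := tower_reduce k P N hNd hNi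
      exact ⟨β, q, fun j hj => hβ j (by omega), tower_normalForm_mono hk hβ h⟩
    · obtain ⟨q, hq⟩ := boxPoly_exists_pt p N hNd hNi
      refine ⟨0, q, fun _ _ => rfl, fun B Z hB hZd hZi => ?_⟩
      have hs := sum_carriers_zero (d := D) B hB (fun _ _ => rfl)
      have e : of N - (∑ j ∈ Finset.Icc 2 D, of (B j)) - of Z =
          (of N - of Z) - ∑ j ∈ Finset.Icc 2 D, of (B j) := by abel
      rw [e]
      exact relations.sub_mem (hq Z hZd hZi) hs
  | zero =>
    refine ⟨0, 0, fun _ _ => rfl, fun B Z hB hZd hZi => ?_⟩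
    have hs := sum_carriers_zero (d := D) B hB (fun _ _ => rfl)
    have e : (0 : FormalRep) - (∑ j ∈ Finset.Icc 2 D, of (B j)) - of Z =
        -(∑ j ∈ Finset.Icc 2 D, of (B j)) - of Z := by abel
    rw [e]
    exact relations.sub_mem (relations.neg_mem hs)
      (pt_zero_mem_relations Z (by rw [hZi]; push_cast; rfl))
  | add y z _ _ ihy ihz =>
    obtain ⟨β₁, q₁, hβ₁, h₁⟩ := ihy
    obtain ⟨β₂, q₂, hβ₂, h₂⟩ := ihz
    exact ⟨β₁ + β₂, q₁ + q₂, fun j hj => by simp [hβ₁ j hj, hβ₂ j hj], towerNF_add h₁ h₂⟩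
  | neg y _ ih =>
    obtain ⟨β, q, hβ, h⟩ := ih
    exact ⟨-β, -q, fun j hj => by simp [hβ j hj], towerNF_neg h⟩

/-! ### The kernel theorem and Conjecture 1 on the tower, under `Indep_ℚ(1, ζ(2), …, ζ(D))` -/

/-- **Conjecture 1, kernel form, on the level-one box tower of height `D` (with all polynomial boxes),
conditionally on the `ℚ`-linear independence of `1, ζ(2), …, ζ(D)`** (hypothesis `hind`, stated as the
vanishing of every rational relation `Σ_{2≤j≤D} n_j ζ(j) + r = 0`): a formal `ℤ`-combination with value
`0` is a Kontsevich–Zagier relation — its normal form has value `Σ β_j ζ(j) + q = 0`, so all `β_j` and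
`q` vanish, and a normal form with zero coefficients is a relation. [cite: KontsevichZagier2001, §1.2 Conjecture 1] -/
theorem tower_mem_relations_of_eval_eq_zero {D : ℕ}
    (hind : ∀ (n : ℕ → ℚ) (r : ℚ), (∑ j ∈ Finset.Icc 2 D, (n j : ℝ) * zetaValue j) + r = 0 →
      r = 0 ∧ ∀ j ∈ Finset.Icc 2 D, n j = 0)
    {c : FormalRep}
    (hc : c ∈ AddSubgroup.closure
      ({y : FormalRep | ∃ (k : ℕ) (_ : k + 2 ≤ D) (P : MvPolynomial (Fin (k + 2)) ℚ)
          (N : IntegralRep (k + 2)), N.domain = {x | ∀ i, x i ∈ Set.Ioo (0:ℝ) 1} ∧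
          EqOn N.integrand (fun x => (MvPolynomial.aeval x P : ℝ) / (1 - ∏ i, x i)) N.domain ∧
          y = of N} ∪
       {y : FormalRep | ∃ (m : ℕ) (p : MvPolynomial (Fin m) ℚ) (N : IntegralRep m),
          N.domain = {x | ∀ i, x i ∈ Set.Ioo (0:ℝ) 1} ∧
          EqOn N.integrand (fun x => (MvPolynomial.aeval x p : ℝ)) N.domain ∧ y = of N}))
    (hv : eval c = 0) : c ∈ relations := by
  obtain ⟨β, q, -, h⟩ := exists_towerNF_of_mem_closure hc
  have hval := tower_value h
  rw [hv] at hval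
  obtain ⟨hq, hβ⟩ := hind β q hval.symm
  obtain ⟨B, hB⟩ := exists_zetaCarriers β
  obtain ⟨Zf, hZf⟩ := exists_ptCarrier
  have hB' : ∀ j ∈ Finset.Icc 2 D, (B j).domain = {x | ∀ i, x i ∈ Set.Ioo (0:ℝ) 1} ∧
      EqOn (B j).integrand (fun x => (β j : ℝ) / (1 - ∏ i, x i)) (B j).domain :=
    fun j hj => hB j (Finset.mem_Icc.1 hj).1
  have e₁ := h B (Zf q) hB' (hZf q).1 (hZf q).2
  have eB := sum_carriers_zero (d := D) B hB' hβ
  have eZ := pt_zero_mem_relations (Zf q) (by rw [(hZf q).2, hq]; push_cast; rfl)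
  have e : c = (c - (∑ j ∈ Finset.Icc 2 D, of (B j)) - of (Zf q)) +
      (∑ j ∈ Finset.Icc 2 D, of (B j)) + of (Zf q) := by abel
  rw [e]
  exact relations.add_mem (relations.add_mem e₁ eB) eZ

/-- **`stub_boxRigidity` on the level-one box tower (Conjecture 1 of Kontsevich–Zagier for all
`[(0,1)ʷ, P(x)/(1 − x₀⋯x_{w−1})]`, `2 ≤ w ≤ D`), conditionally on `Indep_ℚ(1, ζ(2), …, ζ(D))`.** Two
such representations (of possibly different dimensions) with equal values are KZ-equivalent.
[cite: KontsevichZagier2001, §1.2 Conjecture 1] -/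
theorem boxRigidity_levelOne_tower {D : ℕ}
    (hind : ∀ (n : ℕ → ℚ) (r : ℚ), (∑ j ∈ Finset.Icc 2 D, (n j : ℝ) * zetaValue j) + r = 0 →
      r = 0 ∧ ∀ j ∈ Finset.Icc 2 D, n j = 0)
    {k k' : ℕ} (hk : k + 2 ≤ D) (hk' : k' + 2 ≤ D)
    (N : IntegralRep (k + 2)) (N' : IntegralRep (k' + 2))
    (P : MvPolynomial (Fin (k + 2)) ℚ) (P' : MvPolynomial (Fin (k' + 2)) ℚ)
    (hNd : N.domain = {x | ∀ i, x i ∈ Set.Ioo (0:ℝ) 1})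
    (hNi : EqOn N.integrand (fun x => (MvPolynomial.aeval x P : ℝ) / (1 - ∏ i, x i)) N.domain)
    (hN'd : N'.domain = {x | ∀ i, x i ∈ Set.Ioo (0:ℝ) 1})
    (hN'i : EqOn N'.integrand (fun x => (MvPolynomial.aeval x P' : ℝ) / (1 - ∏ i, x i)) N'.domain)
    (hv : N.value = N'.value) : Equivalent N N' := by
  refine tower_mem_relations_of_eval_eq_zero hind (AddSubgroup.sub_mem _
    (AddSubgroup.subset_closure (Or.inl ⟨k, hk, P, N, hNd, hNi, rfl⟩))
    (AddSubgroup.subset_closure (Or.inl ⟨k', hk', P', N', hN'd, hN'i, rfl⟩))) ?_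
  rw [map_sub, eval_of, eval_of, hv, sub_self]

/-- **Mixed pairs on the tower**: a tower member against a polynomial box of any dimension (e.g. a
rational point), conditionally on `Indep_ℚ(1, ζ(2), …, ζ(D))`. [cite: KontsevichZagier2001, §1.2 Conjecture 1] -/
theorem levelOne_tower_equivalent_boxPoly_of_value_eq {D : ℕ}
    (hind : ∀ (n : ℕ → ℚ) (r : ℚ), (∑ j ∈ Finset.Icc 2 D, (n j : ℝ) * zetaValue j) + r = 0 →
      r = 0 ∧ ∀ j ∈ Finset.Icc 2 D, n j = 0)
    {k m : ℕ} (hk : k + 2 ≤ D) (N : IntegralRep (k + 2)) (N' : IntegralRep m)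
    (P : MvPolynomial (Fin (k + 2)) ℚ) (p : MvPolynomial (Fin m) ℚ)
    (hNd : N.domain = {x | ∀ i, x i ∈ Set.Ioo (0:ℝ) 1})
    (hNi : EqOn N.integrand (fun x => (MvPolynomial.aeval x P : ℝ) / (1 - ∏ i, x i)) N.domain)
    (hN'd : N'.domain = {x | ∀ i, x i ∈ Set.Ioo (0:ℝ) 1})
    (hN'i : EqOn N'.integrand (fun x => (MvPolynomial.aeval x p : ℝ)) N'.domain)
    (hv : N.value = N'.value) : Equivalent N N' := by
  refine tower_mem_relations_of_eval_eq_zero hind (AddSubgroup.sub_mem _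
    (AddSubgroup.subset_closure (Or.inl ⟨k, hk, P, N, hNd, hNi, rfl⟩))
    (AddSubgroup.subset_closure (Or.inr ⟨m, p, N', hN'd, hN'i, rfl⟩))) ?_
  rw [map_sub, eval_of, eval_of, hv, sub_self]

/-! ### The independence hypothesis at heights `2` and `3` -/

/-- `ζ(2) = π²/6` for the tree's `zetaValue` (Euler; Mathlib `hasSum_zeta_two`). [folklore] -/
theorem zetaValue_two_eq : zetaValue 2 = Real.pi ^ 2 / 6 := by
  rw [zetaValue]
  exact hasSum_zeta_two.tsum_eq

/-- **Height `2` is unconditional**: `Indep_ℚ(1, ζ(2))` is the irrationality of `π²` (Lindemann;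
`CalegariDimitrovTang.irrational_pi_sq`). [cite: CalegariDimitrovTang2024, remark after Cor. 2] -/
theorem indepZeta_two : ∀ (n : ℕ → ℚ) (r : ℚ),
    (∑ j ∈ Finset.Icc 2 2, (n j : ℝ) * zetaValue j) + r = 0 → r = 0 ∧ ∀ j ∈ Finset.Icc 2 2, n j = 0 := by
  intro n r h
  rw [Finset.Icc_self, Finset.sum_singleton, zetaValue_two_eq] at h
  obtain ⟨hn, hr⟩ := levelOne_rigid_numbers (n 2) r 0 0 (by rw [h]; push_cast; ring)
  refine ⟨hr, fun j hj => ?_⟩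
  rw [Finset.Icc_self, Finset.mem_singleton] at hj
  rw [hj, hn]

/-- **Height `3`**: `Indep_ℚ(1, ζ(2), ζ(3))` from the (open) `ℚ`-linear independence of `1, π², ζ(3)` —
the typed leaf of the first join rung (card `merge-gadget-join-rung`). [cite: KontsevichZagier2001, §1.2] -/
theorem indepZeta_three_of_linearIndependent
    (h : LinearIndependent ℚ ![(1:ℝ), Real.pi ^ 2, zetaValue 3]) : ∀ (n : ℕ → ℚ) (r : ℚ),
    (∑ j ∈ Finset.Icc 2 3, (n j : ℝ) * zetaValue j) + r = 0 → r = 0 ∧ ∀ j ∈ Finset.Icc 2 3, n j = 0 := by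
  intro n r hsum
  have h23 : Finset.Icc 2 3 = {2, 3} := by decide
  rw [h23, Finset.sum_pair (by norm_num), zetaValue_two_eq] at hsum
  rw [Fintype.linearIndependent_iff] at h
  have key := h ![r, n 2 / 6, n 3] (by
    rw [Fin.sum_univ_three]
    simp only [Matrix.cons_val_zero, Matrix.cons_val_one, Matrix.cons_val_two, Matrix.tail_cons,
      Matrix.head_cons, Rat.smul_def]
    push_cast
    linarith)
  have h0 := key 0
  have h1 := key 1
  have h2 := key 2
  simp only [Matrix.cons_val_zero, Matrix.cons_val_one, Matrix.cons_val_two, Matrix.tail_cons,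
    Matrix.head_cons, div_eq_zero_iff, OfNat.ofNat_ne_zero, or_false] at h0 h1 h2
  refine ⟨h0, fun j hj => ?_⟩
  rw [h23, Finset.mem_insert, Finset.mem_singleton] at hj
  rcases hj with rfl | rfl
  · exact h1
  · exact h2

/-- **Conjecture 1 on the tower up to height three** — the first JOIN rung, where `ζ(2)` and `ζ(3)` meet
(`∫∫∫ z dxdydz/(1−xyz) = ζ(2) − 1`, `∫∫∫ dxdydz/(1−xyz) = ζ(3)`): for all pairs of representations
`[(0,1)ʷ, P/(1 − ∏x)]`, `w, w' ∈ {2, 3}`, equal values imply KZ-equivalence, conditionally on the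
`ℚ`-linear independence of `1, π², ζ(3)` (open). [cite: KontsevichZagier2001, §1.2 Conjecture 1] -/
theorem boxRigidity_levelOne_le_three (h : LinearIndependent ℚ ![(1:ℝ), Real.pi ^ 2, zetaValue 3])
    {k k' : ℕ} (hk : k + 2 ≤ 3) (hk' : k' + 2 ≤ 3)
    (N : IntegralRep (k + 2)) (N' : IntegralRep (k' + 2))
    (P : MvPolynomial (Fin (k + 2)) ℚ) (P' : MvPolynomial (Fin (k' + 2)) ℚ)
    (hNd : N.domain = {x | ∀ i, x i ∈ Set.Ioo (0:ℝ) 1})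
    (hNi : EqOn N.integrand (fun x => (MvPolynomial.aeval x P : ℝ) / (1 - ∏ i, x i)) N.domain)
    (hN'd : N'.domain = {x | ∀ i, x i ∈ Set.Ioo (0:ℝ) 1})
    (hN'i : EqOn N'.integrand (fun x => (MvPolynomial.aeval x P' : ℝ) / (1 - ∏ i, x i)) N'.domain)
    (hv : N.value = N'.value) : Equivalent N N' :=
  boxRigidity_levelOne_tower (indepZeta_three_of_linearIndependent h) hk hk' N N' P P' hNd hNi hN'd
    hN'i hv

/-- **Conjecture 1 on the tower at height two, unconditionally** (the dimension-two layer again, now as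
the base of the tower in the `∏`-vocabulary). [cite: KontsevichZagier2001, §1.2 Conjecture 1] -/
theorem boxRigidity_levelOne_tower_two (N N' : IntegralRep (0 + 2))
    (P P' : MvPolynomial (Fin (0 + 2)) ℚ)
    (hNd : N.domain = {x | ∀ i, x i ∈ Set.Ioo (0:ℝ) 1})
    (hNi : EqOn N.integrand (fun x => (MvPolynomial.aeval x P : ℝ) / (1 - ∏ i, x i)) N.domain)
    (hN'd : N'.domain = {x | ∀ i, x i ∈ Set.Ioo (0:ℝ) 1})
    (hN'i : EqOn N'.integrand (fun x => (MvPolynomial.aeval x P' : ℝ) / (1 - ∏ i, x i)) N'.domain)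
    (hv : N.value = N'.value) : Equivalent N N' :=
  boxRigidity_levelOne_tower indepZeta_two le_rfl le_rfl N N' P P' hNd hNi hN'd hN'i hv

/-! ### All heights at once, under the tree's conjecture `PiOddZetaAlgebraicIndependent` -/

/-- The generating sets of the tower subgroups are monotone in the height. [folklore] -/
theorem towerGens_mono {D D' : ℕ} (hDD' : D ≤ D') :
    ({y : FormalRep | ∃ (k : ℕ) (_ : k + 2 ≤ D) (P : MvPolynomial (Fin (k + 2)) ℚ)
          (N : IntegralRep (k + 2)), N.domain = {x | ∀ i, x i ∈ Set.Ioo (0:ℝ) 1} ∧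
          EqOn N.integrand (fun x => (MvPolynomial.aeval x P : ℝ) / (1 - ∏ i, x i)) N.domain ∧
          y = of N} ∪
       {y : FormalRep | ∃ (m : ℕ) (p : MvPolynomial (Fin m) ℚ) (N : IntegralRep m),
          N.domain = {x | ∀ i, x i ∈ Set.Ioo (0:ℝ) 1} ∧
          EqOn N.integrand (fun x => (MvPolynomial.aeval x p : ℝ)) N.domain ∧ y = of N}) ⊆
    ({y : FormalRep | ∃ (k : ℕ) (_ : k + 2 ≤ D') (P : MvPolynomial (Fin (k + 2)) ℚ)
          (N : IntegralRep (k + 2)), N.domain = {x | ∀ i, x i ∈ Set.Ioo (0:ℝ) 1} ∧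
          EqOn N.integrand (fun x => (MvPolynomial.aeval x P : ℝ) / (1 - ∏ i, x i)) N.domain ∧
          y = of N} ∪
       {y : FormalRep | ∃ (m : ℕ) (p : MvPolynomial (Fin m) ℚ) (N : IntegralRep m),
          N.domain = {x | ∀ i, x i ∈ Set.Ioo (0:ℝ) 1} ∧
          EqOn N.integrand (fun x => (MvPolynomial.aeval x p : ℝ)) N.domain ∧ y = of N}) := by
  rintro y (⟨k, hk, P, N, hNd, hNi, rfl⟩ | hy)
  · exact Or.inl ⟨k, hk.trans hDD', P, N, hNd, hNi, rfl⟩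
  · exact Or.inr hy

/-- **Every element of the subgroup generated by the WHOLE level-one box tower (all heights) and all
polynomial boxes lies in a finite-height subgroup.** [folklore] -/
theorem exists_height_of_mem_closure_tower {c : FormalRep}
    (hc : c ∈ AddSubgroup.closure
      ({y : FormalRep | ∃ (k : ℕ) (P : MvPolynomial (Fin (k + 2)) ℚ) (N : IntegralRep (k + 2)),
          N.domain = {x | ∀ i, x i ∈ Set.Ioo (0:ℝ) 1} ∧
          EqOn N.integrand (fun x => (MvPolynomial.aeval x P : ℝ) / (1 - ∏ i, x i)) N.domain ∧
          y = of N} ∪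
       {y : FormalRep | ∃ (m : ℕ) (p : MvPolynomial (Fin m) ℚ) (N : IntegralRep m),
          N.domain = {x | ∀ i, x i ∈ Set.Ioo (0:ℝ) 1} ∧
          EqOn N.integrand (fun x => (MvPolynomial.aeval x p : ℝ)) N.domain ∧ y = of N})) :
    ∃ D : ℕ, c ∈ AddSubgroup.closure
      ({y : FormalRep | ∃ (k : ℕ) (_ : k + 2 ≤ D) (P : MvPolynomial (Fin (k + 2)) ℚ)
          (N : IntegralRep (k + 2)), N.domain = {x | ∀ i, x i ∈ Set.Ioo (0:ℝ) 1} ∧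
          EqOn N.integrand (fun x => (MvPolynomial.aeval x P : ℝ) / (1 - ∏ i, x i)) N.domain ∧
          y = of N} ∪
       {y : FormalRep | ∃ (m : ℕ) (p : MvPolynomial (Fin m) ℚ) (N : IntegralRep m),
          N.domain = {x | ∀ i, x i ∈ Set.Ioo (0:ℝ) 1} ∧
          EqOn N.integrand (fun x => (MvPolynomial.aeval x p : ℝ)) N.domain ∧ y = of N}) := by
  induction hc using AddSubgroup.closure_induction with
  | mem y hy =>
    rcases hy with ⟨k, P, N, hNd, hNi, rfl⟩ | hy
    · exact ⟨k + 2, AddSubgroup.subset_closure (Or.inl ⟨k, le_rfl, P, N, hNd, hNi, rfl⟩)⟩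
    · exact ⟨0, AddSubgroup.subset_closure (Or.inr hy)⟩
  | zero => exact ⟨0, AddSubgroup.zero_mem _⟩
  | add y z _ _ ihy ihz =>
    obtain ⟨D₁, h₁⟩ := ihy
    obtain ⟨D₂, h₂⟩ := ihz
    exact ⟨max D₁ D₂, AddSubgroup.add_mem _
      (AddSubgroup.closure_mono (towerGens_mono (le_max_left _ _)) h₁)
      (AddSubgroup.closure_mono (towerGens_mono (le_max_right _ _)) h₂)⟩
  | neg y _ ih =>
    obtain ⟨D, h⟩ := ih
    exact ⟨D, AddSubgroup.neg_mem _ h⟩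

/-- **Conjecture 1, kernel form, on the ENTIRE level-one box tower (all heights, with all polynomial
boxes), conditionally on the tree's conjecture `PiOddZetaAlgebraicIndependent`** (algebraic independence
of `π, ζ(3), ζ(5), …`, which yields `Indep_ℚ(1, ζ(2), …, ζ(D))` for every `D`,
`indepZeta_of_piOddZetaAlgebraicIndependent`): a formal `ℤ`-combination of level-one box representations
(any dimensions) and polynomial boxes with value `0` is a Kontsevich–Zagier relation.
[cite: KontsevichZagier2001, §1.2 Conjecture 1] -/
theorem tower_mem_relations_of_eval_eq_zero_of_piOddZeta (h : PiOddZetaAlgebraicIndependent)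
    {c : FormalRep}
    (hc : c ∈ AddSubgroup.closure
      ({y : FormalRep | ∃ (k : ℕ) (P : MvPolynomial (Fin (k + 2)) ℚ) (N : IntegralRep (k + 2)),
          N.domain = {x | ∀ i, x i ∈ Set.Ioo (0:ℝ) 1} ∧
          EqOn N.integrand (fun x => (MvPolynomial.aeval x P : ℝ) / (1 - ∏ i, x i)) N.domain ∧
          y = of N} ∪
       {y : FormalRep | ∃ (m : ℕ) (p : MvPolynomial (Fin m) ℚ) (N : IntegralRep m),
          N.domain = {x | ∀ i, x i ∈ Set.Ioo (0:ℝ) 1} ∧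
          EqOn N.integrand (fun x => (MvPolynomial.aeval x p : ℝ)) N.domain ∧ y = of N}))
    (hv : eval c = 0) : c ∈ relations := by
  obtain ⟨D, hD⟩ := exists_height_of_mem_closure_tower hc
  exact tower_mem_relations_of_eval_eq_zero (indepZeta_of_piOddZetaAlgebraicIndependent h D) hD hv

/-- **`stub_boxRigidity` on the entire level-one box tower from `PiOddZetaAlgebraicIndependent`**: any two
representations `[(0,1)^{k+2}, P/(1 − ∏x)]`, `[(0,1)^{k'+2}, P'/(1 − ∏x)]` (any `k, k'`) with equal values
are KZ-equivalent. [cite: KontsevichZagier2001, §1.2 Conjecture 1] -/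
theorem boxRigidity_levelOne_tower_of_piOddZeta (h : PiOddZetaAlgebraicIndependent) {k k' : ℕ}
    (N : IntegralRep (k + 2)) (N' : IntegralRep (k' + 2))
    (P : MvPolynomial (Fin (k + 2)) ℚ) (P' : MvPolynomial (Fin (k' + 2)) ℚ)
    (hNd : N.domain = {x | ∀ i, x i ∈ Set.Ioo (0:ℝ) 1})
    (hNi : EqOn N.integrand (fun x => (MvPolynomial.aeval x P : ℝ) / (1 - ∏ i, x i)) N.domain)
    (hN'd : N'.domain = {x | ∀ i, x i ∈ Set.Ioo (0:ℝ) 1})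
    (hN'i : EqOn N'.integrand (fun x => (MvPolynomial.aeval x P' : ℝ) / (1 - ∏ i, x i)) N'.domain)
    (hv : N.value = N'.value) : Equivalent N N' :=
  boxRigidity_levelOne_tower (indepZeta_of_piOddZetaAlgebraicIndependent h (max (k + 2) (k' + 2)))
    (le_max_left _ _) (le_max_right _ _) N N' P P' hNd hNi hN'd hN'i hv

end Summit.KontsevichZagierPeriods.HurwitzMicroSectors.NormalFormPrinciple.PiBox.LevelOne
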